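import Summits.ResolutionOfSingularities.ResolutionOfSingularities.Theorems.HigherRankTermination.Negative.ResidualSteeringFalseWithoutFG

/-!
# Monomial (Hahn) valuations of rank three over `𝔽_p`: toolkit for negative lemmas on
# `HigherRankTermination` (crux stmt-ResolutionOfSingularities-17045, route `SyzygyFlattening`)

Disprover (cdisprove, gen 2) support file, theorem-only. Used by
`Negative/ResidualSteeringThreeLeFalseWithoutFG` (the witness `K = 𝔽_p(x,y,z)` with its rank-three
monomial valuation). Contents:

* `isFractionRing_valuationSubalgebra` — `K = Frac O` for every valuation subring `O ⊇ k`;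
* `not_isNoetherianRing_valuationSubalgebra` — `a, u ∈ K`, `a ≠ 0`, `u⁻¹ ∉ O`, all `a u⁻ⁿ ∈ O`
  `⇒` `O` is not Noetherian (the principal ideals `(a u⁻ⁿ)` increase strictly);
* for `(HahnSeries (ℤ ×ₗ (ℤ ×ₗ ℤ)) (ZMod p)) = 𝔽_p((t^{(ℤ ×ₗ (ℤ ×ₗ ℤ))}))`, `(ℤ ×ₗ (ℤ ×ₗ ℤ)) = ℤ ×ₗ (ℤ ×ₗ ℤ)`: `hahnVal₃_le_one_iff`, `hahnVal₃_lt_one_iff`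
  (`v x ≤ 1 ↔ 0 ≤ orderTop x`), `orderTop_sub_const_pos` (residue field `𝔽_p`),
  `exists_fstVal₃` (the first-coordinate valuation `x ↦ exp (-(order x).1)`, rank one), and
  `coeff_aeval_single₃` (the coefficient formula making `X i ↦ t^{E i}` injective whenever the
  exponent map `d ↦ Σ dᵢ Eᵢ` is).
-/

set_option linter.dupNamespace false

namespace Summit.ResolutionOfSingularities.ResolutionOfSingularities.Theorems.HigherRankTermination.Negative

open Summit.ResolutionOfSingularities.ResolutionOfSingularities.Theorems.SyzygyFlattening
  (locAt DimZero RegularAlong EventuallyRegularAlong TowerTerminates syzygyIndex)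

/-! ## Generalities on valuation subrings (any field) -/

section General

variable {k K : Type} [Field k] [Field K] [Algebra k K]

/-- `K = Frac O` for every valuation subring `O` of `K` (as a `k`-subalgebra). -/
theorem isFractionRing_valuationSubalgebra (O : ValuationSubring K)
    (hk : ∀ c : k, algebraMap k K c ∈ O) : IsFractionRing ↥(valuationSubalgebra O hk) K := by
  rw [IsFractionRing, isLocalization_iff]
  refine ⟨?_, ?_, ?_⟩
  · intro y
    apply IsUnit.mk0
    intro h
    apply nonZeroDivisors.ne_zero y.2
    exact Subtype.ext h
  · intro z
    by_cases hz : z ∈ O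
    · exact ⟨(⟨z, hz⟩, 1), by simp⟩
    · have hz' : z⁻¹ ∈ O := (ValuationSubring.mem_or_inv_mem _ z).resolve_left hz
      have hz0 : z ≠ 0 := by
        rintro rfl
        exact hz O.zero_mem
      have hzi0 : (⟨z⁻¹, hz'⟩ : ↥(valuationSubalgebra O hk)) ≠ 0 := by
        intro h
        have : z⁻¹ = 0 := congrArg Subtype.val h
        exact hz0 (inv_eq_zero.mp this)
      refine ⟨(1, ⟨⟨z⁻¹, hz'⟩, mem_nonZeroDivisors_of_ne_zero hzi0⟩), ?_⟩
      simp [mul_inv_cancel₀ hz0]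
  · intro x y h
    exact ⟨1, by simpa using Subtype.val_injective h⟩

/-- A valuation subring containing `a, u` with `u⁻¹ ∉ O` but `a * u⁻¹ ^ n ∈ O` for all `n` is not
Noetherian: the principal ideals `(a u⁻ⁿ)` increase strictly. -/
theorem not_isNoetherianRing_valuationSubalgebra (O : ValuationSubring K)
    (hk : ∀ c : k, algebraMap k K c ∈ O) (a u : K) (ha : a ≠ 0) (hu : u⁻¹ ∉ O)
    (hmem : ∀ n : ℕ, a * u⁻¹ ^ n ∈ O) :
    ¬ IsNoetherianRing ↥(valuationSubalgebra O hk) := by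
  intro hN
  set A := valuationSubalgebra O hk
  have hu0 : u ≠ 0 := by
    rintro rfl
    exact hu (by rw [inv_zero]; exact O.zero_mem)
  -- the chain of principal ideals
  let e : ℕ → ↥A := fun n => ⟨a * u⁻¹ ^ n, hmem n⟩
  have hstep : ∀ n, e n = e (n + 1) * ⟨u, ?_⟩ := ?_
  rotate_left
  · -- `u ∈ O` since `u⁻¹ ∉ O`
    exact (O.mem_or_inv_mem u).resolve_right hu
  · intro n
    apply Subtype.ext
    show a * u⁻¹ ^ n = a * u⁻¹ ^ (n + 1) * u
    rw [pow_succ, mul_assoc, mul_assoc, inv_mul_cancel₀ hu0, mul_one]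
  let f : ℕ →o Ideal ↥A :=
    { toFun := fun n => Ideal.span {e n}
      monotone' := by
        refine monotone_nat_of_le_succ fun n => ?_
        rw [Ideal.span_singleton_le_iff_mem, Ideal.mem_span_singleton']
        exact ⟨⟨u, (O.mem_or_inv_mem u).resolve_right hu⟩, by rw [mul_comm]; exact (hstep n).symm⟩ }
  obtain ⟨n, hn⟩ := (monotone_stabilizes_iff_noetherian.mpr
    ((isNoetherianRing_iff_ideal_fg ↥A).mpr fun I => IsNoetherian.noetherian I)) f
  have hle : Ideal.span {e (n + 1)} ≤ Ideal.span {e n} := (hn (n + 1) (Nat.le_succ n)).symm.le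
  rw [Ideal.span_singleton_le_iff_mem, Ideal.mem_span_singleton'] at hle
  obtain ⟨c, hc⟩ := hle
  -- `c * (a u⁻ⁿ) = a u⁻ⁿ⁻¹` forces `c = u⁻¹ ∈ O`
  apply hu
  have hc' : (c : K) * (a * u⁻¹ ^ n) = a * u⁻¹ ^ (n + 1) := congrArg Subtype.val hc
  have hne : a * u⁻¹ ^ n ≠ 0 := mul_ne_zero ha (pow_ne_zero _ (inv_ne_zero hu0))
  have : (c : K) = u⁻¹ := by
    have h2 : a * u⁻¹ ^ (n + 1) = u⁻¹ * (a * u⁻¹ ^ n) := by ring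
    rw [h2] at hc'
    exact mul_right_cancel₀ hne hc'
  rw [← this]
  exact c.2

/-- A valuation subring is a local ring whose regularity forces Noetherianity. -/
theorem not_isRegularLocalRing_of_not_isNoetherianRing (O : ValuationSubring K)
    (hk : ∀ c : k, algebraMap k K c ∈ O) (h : ¬ IsNoetherianRing ↥(valuationSubalgebra O hk)) :
    ¬ IsRegularLocalRing ↥(valuationSubalgebra O hk) := by
  intro hR
  exact h inferInstance

end General

/-! ## Hahn series over `Γ₃ = ℤ ×ₗ (ℤ ×ₗ ℤ)`: the rank-three valuation and its rank-one coarsening -/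

section Hahn

variable (p : ℕ) [hp : Fact p.Prime]


/-- `hahn x ≤ 1 ↔ 0 ≤ orderTop x` for the Hahn valuation of `𝔽_p((t^{Γ₃}))`. -/
theorem hahnVal₃_le_one_iff (x : (HahnSeries (ℤ ×ₗ (ℤ ×ₗ ℤ)) (ZMod p))) :
    AddValuation.toValuation (HahnSeries.addVal (ℤ ×ₗ (ℤ ×ₗ ℤ)) (ZMod p)) x ≤ 1 ↔
      (0 : WithTop (ℤ ×ₗ (ℤ ×ₗ ℤ))) ≤ x.orderTop := by
  rw [show (1 : Multiplicative (WithTop (ℤ ×ₗ (ℤ ×ₗ ℤ)))ᵒᵈ) = Multiplicative.ofAdd (OrderDual.toDual 0) from rfl]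
  simp only [AddValuation.toValuation_apply, HahnSeries.addVal_apply, Multiplicative.ofAdd_le,
    OrderDual.toDual_le_toDual]

/-- `hahn x < 1 ↔ 0 < orderTop x`. -/
theorem hahnVal₃_lt_one_iff (x : (HahnSeries (ℤ ×ₗ (ℤ ×ₗ ℤ)) (ZMod p))) :
    AddValuation.toValuation (HahnSeries.addVal (ℤ ×ₗ (ℤ ×ₗ ℤ)) (ZMod p)) x < 1 ↔
      (0 : WithTop (ℤ ×ₗ (ℤ ×ₗ ℤ))) < x.orderTop := by
  rw [show (1 : Multiplicative (WithTop (ℤ ×ₗ (ℤ ×ₗ ℤ)))ᵒᵈ) = Multiplicative.ofAdd (OrderDual.toDual 0) from rfl]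
  simp only [AddValuation.toValuation_apply, HahnSeries.addVal_apply, Multiplicative.ofAdd_lt,
    OrderDual.toDual_lt_toDual]

/-- A series of non-negative order minus its constant term has positive order. -/
theorem orderTop_sub_const_pos (y : (HahnSeries (ℤ ×ₗ (ℤ ×ₗ ℤ)) (ZMod p))) (hy : (0 : WithTop (ℤ ×ₗ (ℤ ×ₗ ℤ))) ≤ y.orderTop) :
    (0 : WithTop (ℤ ×ₗ (ℤ ×ₗ ℤ))) < (y - HahnSeries.single 0 (y.coeff 0)).orderTop := by
  set z : (HahnSeries (ℤ ×ₗ (ℤ ×ₗ ℤ)) (ZMod p)) := y - HahnSeries.single 0 (y.coeff 0) with hzdef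
  have hcoeff : ∀ j : (ℤ ×ₗ (ℤ ×ₗ ℤ)), j ≤ 0 → z.coeff j = 0 := by
    intro j hj
    rcases hj.lt_or_eq with hj | rfl
    · have h1 : y.coeff j = 0 :=
        HahnSeries.coeff_eq_zero_of_lt_orderTop ((WithTop.coe_lt_coe.mpr hj).trans_le hy)
      have h2 : (HahnSeries.single (0 : (ℤ ×ₗ (ℤ ×ₗ ℤ))) (y.coeff 0)).coeff j = 0 :=
        HahnSeries.coeff_single_of_ne hj.ne
      simp [hzdef, h1, h2]
    · simp [hzdef]
  have hge : (0 : WithTop (ℤ ×ₗ (ℤ ×ₗ ℤ))) ≤ z.orderTop :=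
    HahnSeries.le_orderTop_iff_forall.mpr fun j hj => hcoeff j (WithTop.coe_lt_coe.mp hj).le
  rcases hge.lt_or_eq with h | h
  · exact h
  · exfalso
    exact HahnSeries.coeff_orderTop_ne h.symm (hcoeff 0 le_rfl)

/-- **The first-coordinate valuation** of `𝔽_p((t^{Γ₃}))`: `v x = exp (-(order x).1)` for
`x ≠ 0` (the rank-one coarsening of the Hahn valuation). Existential, so no data is declared. -/
theorem exists_fstVal₃ : ∃ v : Valuation (HahnSeries (ℤ ×ₗ (ℤ ×ₗ ℤ)) (ZMod p)) (WithZero (Multiplicative ℤ)),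
    ∀ x : (HahnSeries (ℤ ×ₗ (ℤ ×ₗ ℤ)) (ZMod p)), x ≠ 0 → v x = WithZero.exp (-(ofLex x.order).1) := by
  classical
  refine ⟨{ toFun := fun x => if x = 0 then 0 else WithZero.exp (-(ofLex x.order).1)
            map_zero' := if_pos rfl
            map_one' := ?_
            map_mul' := ?_
            map_add_le_max' := ?_ }, fun x hx => if_neg hx⟩
  · rw [if_neg one_ne_zero, HahnSeries.order_one]
    rfl
  · intro x y
    by_cases hx : x = 0
    · rw [hx, zero_mul, if_pos rfl, zero_mul]
    by_cases hy : y = 0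
    · rw [hy, mul_zero, if_pos rfl, mul_zero]
    rw [if_neg (mul_ne_zero hx hy), if_neg hx, if_neg hy, HahnSeries.order_mul hx hy, ofLex_add,
      Prod.fst_add, neg_add, WithZero.exp_add]
  · intro x y
    by_cases hxy : x + y = 0
    · rw [hxy, if_pos rfl]
      exact zero_le
    by_cases hx : x = 0
    · rw [if_neg hxy, if_pos hx, hx, zero_add, if_neg (by simpa [hx] using hxy)]
      exact le_max_right _ _
    by_cases hy : y = 0
    · rw [if_neg hxy, if_pos hy, hy, add_zero, if_neg (by simpa [hy] using hxy)]
      exact le_max_left _ _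
    rw [if_neg hxy, if_neg hx, if_neg hy]
    have h := HahnSeries.min_order_le_order_add hxy
    rcases le_total x.order y.order with hle | hle
    · rw [min_eq_left hle] at h
      exact le_max_of_le_left (WithZero.exp_le_exp.mpr (neg_le_neg (Prod.Lex.monotone_fst _ _ h)))
    · rw [min_eq_right hle] at h
      exact le_max_of_le_right (WithZero.exp_le_exp.mpr (neg_le_neg (Prod.Lex.monotone_fst _ _ h)))

/-- **The monomial embedding is injective on polynomials**: the coefficient of
`aeval (i ↦ t^{Eᵢ}) f` at `d₀E₀ + d₁E₁ + d₂E₂` is `coeff d f`, where `E₀ = (1,0,0)`, `E₁ = (0,1,0)`,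
`E₂ = (0,0,1)`. -/
theorem coeff_aeval_single₃ (E : Fin 3 → (ℤ ×ₗ (ℤ ×ₗ ℤ)))
    (hE : ∀ d d' : Fin 3 →₀ ℕ, d 0 • E 0 + d 1 • E 1 + d 2 • E 2 = d' 0 • E 0 + d' 1 • E 1 + d' 2 • E 2 → d = d')
    (f : MvPolynomial (Fin 3) (ZMod p)) (d : Fin 3 →₀ ℕ) :
    (MvPolynomial.aeval (fun i => HahnSeries.single (E i) (1 : ZMod p)) f).coeff
      (d 0 • E 0 + d 1 • E 1 + d 2 • E 2) = f.coeff d := by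
  classical
  have hprod : ∀ d' : Fin 3 →₀ ℕ, (∏ i, HahnSeries.single (E i) (1 : ZMod p) ^ d' i) =
      HahnSeries.single (d' 0 • E 0 + d' 1 • E 1 + d' 2 • E 2) 1 := by
    intro d'
    rw [Fin.prod_univ_three]
    simp only [HahnSeries.single_pow, one_pow, HahnSeries.single_mul_single, mul_one]
  rw [MvPolynomial.aeval_eq_eval₂Hom, MvPolynomial.coe_eval₂Hom, MvPolynomial.eval₂_eq',
    HahnSeries.coeff_sum]
  simp only [hprod]
  have hterm : ∀ d' : Fin 3 →₀ ℕ, (algebraMap (ZMod p) (HahnSeries (ℤ ×ₗ (ℤ ×ₗ ℤ)) (ZMod p)) (f.coeff d') *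
      HahnSeries.single (d' 0 • E 0 + d' 1 • E 1 + d' 2 • E 2) 1).coeff
        (d 0 • E 0 + d 1 • E 1 + d 2 • E 2) = if d' = d then f.coeff d' else 0 := by
    intro d'
    rw [← HahnSeries.C_eq_algebraMap, HahnSeries.C_apply, HahnSeries.single_mul_single, zero_add,
      mul_one, HahnSeries.coeff_single]
    by_cases h : d' = d
    · subst h
      simp
    · have h' : d 0 • E 0 + d 1 • E 1 + d 2 • E 2 ≠ d' 0 • E 0 + d' 1 • E 1 + d' 2 • E 2 :=
        fun hh => h (hE d' d hh.symm)
      rw [if_neg h', if_neg h]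
  simp only [hterm, Finset.sum_ite_eq', MvPolynomial.mem_support_iff, ne_eq, ite_not]
  by_cases h0 : f.coeff d = 0
  · simp [h0]
  · simp [h0]

end Hahn

end Summit.ResolutionOfSingularities.ResolutionOfSingularities.Theorems.HigherRankTermination.Negative
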